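import Summits.Langlands.Langlands.Theorems.IrreducibilityBySelfDualityReciprocityUpToIrreducibilitySatakeHalfRegularSector
import Literature.NumberTheory.Automorphic.ClozelCArithmetic
import HarnessLib

/-!
# ArithmeticDialSplit — HEART (module 1 of the lens-4 g37 node `ArithmeticDialSplit`, decomp-langlands)

**Buzzard–Gee L-arithmeticity of REGULAR L-algebraic cuspidal representations of `GL_n` over ANY number field**
(Clozel 1990, Thm. 3.13 + the Buzzard–Gee half-twist), proved in the tree modulo the named fact
`Literature.NumberTheory.Automorphic.Clozel1990_cArithmetic` (taken as a hypothesis `(hC : Clozel1990_cArithmetic)`):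

* `isLArithmetic_of_isLAlgebraic_of_isRegular (hC) … : ∃ E : Subfield ℂ, FiniteDimensional ℚ E ∧ ∀ᶠ v, ∀ α,
  π.1.HasSatakeParamAt v α → ∀ k, coeff_k (∏_{a ∈ α} (X − a)) ∈ E` — LITERALLY the δ-unfolding of the tree's
  `AutomorphicRepData.IsLArithmetic π.1` (Buzzard–Gee 2014, Def. 3.1.3; `BuzzardGeeArithmetic.lean`) that the
  lens-4 g36 pieces TOR° / TOR_res (`Theorems/TorusPricingSplit.lean`) carry as their `π`-dial.

PROOF (≈ Böckle–Hui 2025 §3.1, «by [Cl90] `π` is C-arithmetic; by [BG14] `π` is C-arithmetic iff `π ⊗ |det|^{(1−n)/2}` is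
L-arithmetic»), entirely with tree tools: the regular algebraic twist `πt = π ⊗ |det|^{(n−1)/2}`
(`exists_twist_isRegularAlgebraic_of_isLAlgebraic_of_isRegular`, regular-sector file of route IrreducibilityBySelfDuality) has
Satake parameter `β = q_v^{−(n−1)/2} α` (`HasSatakeParamAt.of_map_mulChar_detTwist_of_cpow`); Clozel's fact puts the
integrally normalised Hecke eigenvalues `t_{v,i} = q_v^{i(n−i)/2} e_i(β) = q_v^{i(n−i)/2 − i(n−1)/2} e_i(α)` of `πt` in one number
field `E` for almost all `v`; and the PARITY IDENTITY `i(n−1) = i(n−i) + i(i−1)` gives `e_i(α) = q_v^{i(i−1)/2} · t_{v,i} ∈ E`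
(an INTEGER power of `q_v` — no `√q_v`, for every parity of `n`), whence Vieta.  `K` is ANY number field (Clozel's theorem is
stated for every number field: Patrikis 2019 Thm. 3.2.1), so this discharges the L-arithmeticity antecedent of TOR° on the whole
REGULAR sector — not only over totally real / CM fields where Galois representations exist.

Consumers: module 2 (`Theorems/ArithmeticDialSplit.lean`: `rtor_of_tor0`); the regular rungs of the cruxes
`Theses.HeckeFieldDeRham.LArithmeticity` (stmt-Langlands-17409) and `Theses.TranscendenceCarving.LArithmeticity`, and the
L-arithmeticity half of `Theses.DeterminantTowerSplit.IntegralFrobeniusData` (lens-3-g16 INT) — all of which quote Clozel 3.13 as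
«known one sector up» without a tree proof.  [cite: Clozel1990, Thm. 3.13] [cite: Patrikis2019, Thm. 3.2.1]
[cite: BockleHui2025, §3.1] [cite: BuzzardGeeLMS2014, Def. 3.1.3–3.1.4, Lemma 3.1 and §5.3]
-/

set_option linter.dupNamespace false
set_option linter.style.longLine false

noncomputable section

namespace Summit.Langlands.Langlands.Theorems.ArithmeticDialSplit

open scoped NumberField Classical Polynomial
open Filter IsDedekindDomain Polynomial
open Literature.NumberTheory.Automorphic Literature.NumberTheory.GaloisRepresentations
open Summit.Langlands.Langlands.Theorems.ReciprocityUpToIrreducibility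
  (ofReal_sqrt_pow_pred_eq_cpow exists_twist_isRegularAlgebraic_of_isLAlgebraic_of_isRegular)

variable {K : Type} [Field K] [NumberField K] {n : ℕ}

/-! ## §1 Clozel ⟹ Buzzard–Gee L-arithmeticity on the regular sector (every number field, every rank)

Bookkeeping used inside the proofs (inlined as local `have`s, not filed as lemmas): `e_i(z·α) = zⁱ e_i(α)` (Mathlib `Multiset.pow_smul_esymm` read with
`•` = `*`) and the PARITY IDENTITY `i(n−1) = i(n−i) + i(i−1)` for `i ≤ n` — the integer-exponent form of Buzzard–Gee's «C-arithmetic ⟺ the half-twist is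
L-arithmetic» [cite: BuzzardGeeLMS2014, §5.3]. -/

/-- **Every Satake elementary symmetric function of a regular L-algebraic cuspidal `π` lies in Clozel's number field of its
regular algebraic twist.**  For `π` cuspidal on `GL_n(𝔸_K)` (`n ≥ 1`, `K` ANY number field), L-algebraic with a regular infinity
type, and `E` the number field of `Clozel1990_cArithmetic` for `πt = π ⊗ |det|^{(n−1)/2}`: at almost every `v`, every Satake
parameter `α` of `π` at `v` has `e_i(α) ∈ E` for all `i ≤ n` — indeed `e_i(α) = q_v^{i(i−1)/2} · t_{v,i}(πt)`.
[cite: Clozel1990, Thm. 3.13] [cite: BockleHui2025, §3.1] [cite: BuzzardGeeLMS2014, §5.3] -/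
theorem exists_numberField_esymm_mem (hC : Clozel1990_cArithmetic)
    (hcpt : isCompact_glFiniteIntegralLevel n K) (hn : 0 < n)
    (π : CuspidalAutomorphicRepData n K hcpt) (hL : π.1.IsLAlgebraic)
    (hreg : ∃ T : InfinityType K n, π.1.HasInfinityType T ∧ T.IsRegular) :
    ∃ E : Subfield ℂ, FiniteDimensional ℚ E ∧
      ∀ᶠ v : HeightOneSpectrum (𝓞 K) in cofinite, ∀ α : Multiset ℂ, π.1.HasSatakeParamAt v α →
        ∀ i ≤ n, α.esymm i ∈ E := by
  haveI : NeZero n := ⟨hn.ne'⟩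
  obtain ⟨χ, πt, hχ, hW, hW', hπt⟩ := exists_twist_isRegularAlgebraic_of_isLAlgebraic_of_isRegular π hL hreg
  obtain ⟨E, hEfin, hE⟩ := hC n K hcpt πt hπt
  refine ⟨E, hEfin, hE.mono fun v hv α hα i hi => ?_⟩
  -- notation: `q = q_v`, `sq = √q_v ∈ ℂ`, `z = q_v^{-(n-1)/2}`
  have hq1 : 1 < v.residueCard := v.one_lt_residueCard
  have hq0 : (v.residueCard : ℂ) ≠ 0 := Nat.cast_ne_zero.mpr (lt_trans zero_lt_one hq1).ne'
  have hsq0 : (((Real.sqrt (v.residueCard : ℝ)) : ℝ) : ℂ) ≠ 0 := by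
    have : (0 : ℝ) < Real.sqrt (v.residueCard : ℝ) :=
      Real.sqrt_pos.mpr (by exact_mod_cast lt_trans zero_lt_one hq1)
    exact_mod_cast this.ne'
  have hsq2 : (((Real.sqrt (v.residueCard : ℝ)) : ℝ) : ℂ) ^ 2 = (v.residueCard : ℂ) := by
    rw [← Complex.ofReal_pow, Real.sq_sqrt (Nat.cast_nonneg _), Complex.ofReal_natCast]
  -- the Satake parameter of the twist and Clozel's eigenvalue
  have hβ := AutomorphicRepData.HasSatakeParamAt.of_map_mulChar_detTwist_of_cpow hχ hW hW' hα
  have ht := hv _ hβ i hi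
  -- `√q^(n-1) · z = 1`
  have hwz : (((Real.sqrt (v.residueCard : ℝ)) : ℝ) : ℂ) ^ (n - 1) *
      (v.residueCard : ℂ) ^ (-((((n : ℝ) - 1) / 2 : ℝ) : ℂ)) = 1 := by
    rw [ofReal_sqrt_pow_pred_eq_cpow _ hn, ← Complex.cpow_add _ _ hq0, add_neg_cancel, Complex.cpow_zero]
  have hcard : Multiset.card α = n := hα.card_eq
  -- unfold the eigenvalue: `t = sq^(i(n-i)) * (z^i * e_i(α))`
  have hes : (α.map (((v.residueCard : ℂ) ^ (-((((n : ℝ) - 1) / 2 : ℝ) : ℂ))) * ·)).esymm i =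
      ((v.residueCard : ℂ) ^ (-((((n : ℝ) - 1) / 2 : ℝ) : ℂ))) ^ i * α.esymm i := by
    have h := Multiset.pow_smul_esymm ((v.residueCard : ℂ) ^ (-((((n : ℝ) - 1) / 2 : ℝ) : ℂ))) i α
    simp only [smul_eq_mul] at h
    exact h.symm
  have ht' : heckeEigenvalueOf n v (α.map (((v.residueCard : ℂ) ^ (-((((n : ℝ) - 1) / 2 : ℝ) : ℂ))) * ·)) i =
      (((Real.sqrt (v.residueCard : ℝ)) : ℝ) : ℂ) ^ (i * (n - i)) *
        (((v.residueCard : ℂ) ^ (-((((n : ℝ) - 1) / 2 : ℝ) : ℂ))) ^ i * α.esymm i) := by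
    simp only [heckeEigenvalueOf, hes]
  -- the parity identity `i(n-1) = i(n-i) + i(i-1)` (`i ≤ n`)
  have hpar : i * (n - 1) = i * (n - i) + i * (i - 1) := by
    rcases Nat.eq_zero_or_pos i with rfl | hi0
    · simp
    · rw [← mul_add]
      congr 1
      omega
  -- the parity identity: `e_i(α) = q^(i(i-1)/2) * t`
  have h2 : i * (i - 1) = 2 * (i * (i - 1) / 2) := (Nat.mul_div_cancel' (Nat.even_mul_pred_self i).two_dvd).symm
  have key : α.esymm i = (v.residueCard : ℂ) ^ (i * (i - 1) / 2) *
      heckeEigenvalueOf n v (α.map (((v.residueCard : ℂ) ^ (-((((n : ℝ) - 1) / 2 : ℝ) : ℂ))) * ·)) i := by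
    rw [ht']
    have h1 : (((Real.sqrt (v.residueCard : ℝ)) : ℝ) : ℂ) ^ (i * (n - 1)) *
        ((v.residueCard : ℂ) ^ (-((((n : ℝ) - 1) / 2 : ℝ) : ℂ))) ^ i = 1 := by
      rw [mul_comm i (n - 1), pow_mul, ← mul_pow, hwz, one_pow]
    have h3 : (((Real.sqrt (v.residueCard : ℝ)) : ℝ) : ℂ) ^ (i * (i - 1)) = (v.residueCard : ℂ) ^ (i * (i - 1) / 2) := by
      rw [h2, pow_mul, hsq2, ← h2]
    calc α.esymm i
        = ((((Real.sqrt (v.residueCard : ℝ)) : ℝ) : ℂ) ^ (i * (n - 1)) *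
            ((v.residueCard : ℂ) ^ (-((((n : ℝ) - 1) / 2 : ℝ) : ℂ))) ^ i) * α.esymm i := by rw [h1, one_mul]
      _ = (((Real.sqrt (v.residueCard : ℝ)) : ℝ) : ℂ) ^ (i * (i - 1)) *
            ((((Real.sqrt (v.residueCard : ℝ)) : ℝ) : ℂ) ^ (i * (n - i)) *
              (((v.residueCard : ℂ) ^ (-((((n : ℝ) - 1) / 2 : ℝ) : ℂ))) ^ i * α.esymm i)) := by
          rw [hpar, pow_add]; ring
      _ = _ := by rw [h3]
  rw [key]
  exact mul_mem (pow_mem (natCast_mem E _) _) ht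

/-- **Clozel ⟹ Buzzard–Gee L-arithmeticity for regular L-algebraic cuspidal `π` on `GL_n` over ANY number field** — the
δ-unfolding of `AutomorphicRepData.IsLArithmetic π.1` VERBATIM (one number field `E ⊆ ℂ` containing, for almost all `v` and every
Satake parameter `α` of `π` at `v`, every coefficient of `∏_{a ∈ α} (X − a)`), from `exists_numberField_esymm_mem` by Vieta
(`Multiset.prod_X_sub_C_coeff`; coefficients above the degree `n = |α|` vanish).  This is the regular case of Buzzard–Gee's
Conjecture 3.1.5 (`lArithmetic_of_lAlgebraic`), «known by Clozel Thm. 3.13» — here a tree theorem modulo the named fact.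
[cite: Clozel1990, Thm. 3.13] [cite: Patrikis2019, Thm. 3.2.1] [cite: BockleHui2025, §3.1] [cite: BuzzardGeeLMS2014, Def. 3.1.3, Conj. 3.1.5] -/
theorem isLArithmetic_of_isLAlgebraic_of_isRegular (hC : Clozel1990_cArithmetic)
    (hcpt : isCompact_glFiniteIntegralLevel n K) (hn : 0 < n)
    (π : CuspidalAutomorphicRepData n K hcpt) (hL : π.1.IsLAlgebraic)
    (hreg : ∃ T : InfinityType K n, π.1.HasInfinityType T ∧ T.IsRegular) :
    ∃ E : Subfield ℂ, FiniteDimensional ℚ ↥E ∧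
      ∀ᶠ v : IsDedekindDomain.HeightOneSpectrum (NumberField.RingOfIntegers K) in Filter.cofinite, ∀ α : Multiset ℂ,
        π.1.HasSatakeParamAt v α → ∀ k : ℕ,
          ((α.map fun a => (Polynomial.X - Polynomial.C a : Polynomial ℂ)).prod).coeff k ∈ E := by
  obtain ⟨E, hEfin, hE⟩ := exists_numberField_esymm_mem hC hcpt hn π hL hreg
  refine ⟨E, hEfin, hE.mono fun v hv α hα k => ?_⟩
  have hcard : Multiset.card α = n := hα.card_eq
  by_cases hk : k ≤ Multiset.card α
  · rw [Multiset.prod_X_sub_C_coeff α hk]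
    exact mul_mem (pow_mem (neg_mem (one_mem E)) _) (hv α hα _ (by rw [← hcard]; exact Nat.sub_le _ _))
  · rw [Polynomial.coeff_eq_zero_of_natDegree_lt]
    · exact zero_mem E
    · rw [Polynomial.natDegree_multiset_prod_X_sub_C_eq_card]; omega

end Summit.Langlands.Langlands.Theorems.ArithmeticDialSplit

end
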